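import Literature.IUT.HodgeTheaters.CoveringsErrata
import Literature.AnabelianGeometry.SemiGraphs.PSCUnrVerticialNecessityProofs
import Literature.AnabelianGeometry.SemiGraphs.PSCCoveringDatumRamificationProofs
import Literature.AnabelianGeometry.SemiGraphs.PSCCoveringBranchData
import Literature.AnabelianGeometry.SemiGraphs.PSCCoveringDatumRamificationLevels
import Literature.AnabelianGeometry.SemiGraphs.PSCVertexStabilizerCharacterizationBodies
import Literature.AnabelianGeometry.SemiGraphs.PSCCoveringBranchDataProofs
import Literature.AnabelianGeometry.SemiGraphs.PSCVertexQuotientConverseProofs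
import Literature.AnabelianGeometry.SemiGraphs.PSCVertexQuotientPrimeProofs
import Literature.AnabelianGeometry.SemiGraphs.PSCVertexQuotientConversePrimeProofs
import HarnessLib

/-!
# [IUTchI] Remark 1.2.3 (vii), second sentence (necessity in [CombGC] Thm. 1.6 (iii)): conditional discharge

S. Mochizuki, *Inter-universal Teichmüller theory I*, kurims manuscript (May 2020), Remark 1.2.3
(vii), p. 43 — the replacement text of the final paragraph of the proof of [CombGC] Theorem 1.6 (iii):
"On the other hand, necessity follows formally from the characterization of unramified verticial
subgroups given in Remark 1.4.3 and the characterization of verticially purely totally ramified finite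
étale coverings given in Remark 1.4.2" ([IUTchI] Rmk 1.2.3 (vii) p.43) [claim: Mochizuki2012,
status: disputed].  abc-iut-L5-t6 typed the sentence as the fact
`Rmk123.UnrVerticialNecessityReduction Ω` (`CoveringsErrata.lean`; cell FACT-LIST F-1980).

The kernel of the sentence now exists in the tree: abc-iut-w5-d174's
`PSCDatum.isUnrGroupTheoreticallyVerticial_of_isUnrVerticiallyFiltrationPreserving`
(`PSCUnrVerticialNecessityProofs.lean`, over abc-iut-L5-t6's level-wise reduction
`isUnrGroupTheoreticallyVerticial_of_levelwise` and rank transport `grphRank_eq_unrTransport`).  Its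
inputs are the two printed characterizations APPLIED FUNCTORIALLY — to every finite étale
`Π^unr`-covering `G_U` — exactly as the print prescribes ("a characterization which may also be applied
to finite étale `Π^unr_G`-coverings of `G`", Rmk. 1.2.3 (iv) p. 42): the level-wise form of Rmk. 1.4.2
(`hRC`, cell GAP row G-w5d174-2), the connectivity bound `i ≤ n + 1` for the dual graphs of
the coverings (G-w5d174-3, typed by abc-iut-w4-d052 as `PSCDatum.VertCountLeNodeCountSuccHolds Ω`), and Rmk. 1.2.3 (iv) read on stabilizers (`hVC`, G-w5d174-1); plus
[CombGC] Rmk. 1.1.3 (`AbelianizedGrphRank`, from abc-iut-w4-d052's `RankStatementsHold Ω`) and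
profiniteness of the data.

PROVED here: `Rmk123.unrVerticialNecessityReduction_of_levelwise` — for every origin predicate `Ω`
whose data are profinite and satisfy those LEVEL-WISE statements (taken as hypotheses quantified over
`Ω`-type data; the cell's sub-node statements T16-L16b/c/d, to be consumed BY NAME once typed), the
fact `UnrVerticialNecessityReduction Ω` holds.  Honest residue: the TOP-LEVEL hypotheses displayed in
the typed fact (`UnrVerticialSplitInjection`, `ElementaryQuotientVerticiallyRamifiedIff`,
`VerticialPureRamificationCount` for `G`, `H`) are idle on this route — the print's "formally" needs the
characterizations at every level, not only at `G`; the level-wise `hVC`/`hRC` are expected to follow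
from those top-level statements applied to the covering data `G_U` (abc-iut-L3-t4's
`PSCDatum.restrict`, count/subgroup transfer) — not done here.  ([CombGC] Thm. 1.6 (iii) AS PRINTED,
`PSCDatum.UnrVerticialIffHolds Ω`, has no `Σ = {l}` hypothesis: it needs in addition the reduction
"we may assume `Σ = {l}`" ([CombGC] p. 14; cell row T16-L04, the change-of-`Σ` functor) and is not
derived here.)  Proof-only; nothing here takes a side on [IUTchIII] Cor. 3.12.
-/

open Topology

universe u

namespace Literature.IUT.HodgeTheaters.Rmk123

open Literature.AnabelianGeometry.SemiGraphs
open scoped Pointwise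

/-- **[IUTchI] Remark 1.2.3 (vii), necessity, for every profinite origin predicate satisfying the
level-wise characterizations**: if every datum `G` of `Ω`-PSC-type has profinite `Π` (compact, totally
disconnected — as the pro-`Σ` completions of [CombGC] Def. 1.1 (i) are), satisfies [CombGC] Rmk.
1.1.3/1.3.1 (`RankStatementsHold Ω`), and satisfies FOR EVERY `Π^unr`-covering `G_U` (i) Rmk. 1.4.2's
criterion in the covering's own counts (`hRC`, cell row G-w5d174-2), (ii) the connectivity bound
`i(G_U) ≤ n(G_U) + 1` (`VertCountLeNodeCountSuccHolds Ω`, BY NAME) and (iii) Rmk. 1.2.3 (iv)'s vertex characterization read on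
stabilizers (`hVC`, G-w5d174-1), then `UnrVerticialNecessityReduction Ω` — verticially
filtration-preserving ⟹ group-theoretically verticial for sturdy `G`, `H` of `Ω`-type at `Σ = {l}` —
holds, by abc-iut-w5-d174's kernel (BY NAME).  The top-level hypotheses displayed inside the typed fact
are not used. [cite: Mochizuki2012, IUTchI Rmk 1.2.3 (vii) p.43] -/
theorem unrVerticialNecessityReduction_of_levelwise (Ω : PSCOrigin.{u})
    (hcpt : ∀ ⦃Q : Type u⦄ [Group Q] [TopologicalSpace Q] (G : PSCDatum Q),
      Ω.IsOfPSCType G → CompactSpace Q)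
    (htd : ∀ ⦃Q : Type u⦄ [Group Q] [TopologicalSpace Q] (G : PSCDatum Q),
      Ω.IsOfPSCType G → TotallyDisconnectedSpace Q)
    (hrank : PSCDatum.RankStatementsHold Ω)
    (hRC : ∀ ⦃Q : Type u⦄ [Group Q] [TopologicalSpace Q] [IsTopologicalGroup Q] (G : PSCDatum Q),
      Ω.IsOfPSCType G → ∀ (l k : ℕ) (U H' : Subgroup Q), G.Sigma = {l} → 0 < k → U.Normal →
      IsOpen (U : Set Q) → G.unrKer ≤ U → H' ≤ U → (H'.subgroupOf U).Normal → IsOpen (H' : Set Q) →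
      H'.relIndex U = l ^ k → G.unrKer ≤ H' →
      (G.nodeCount H' = G.nodeCount U * H'.relIndex U ∧
        (G.IsVerticiallyPurelyTotallyRamified U H' ↔
          (G.vertCount H' : ℤ) = (H'.relIndex U : ℤ) * ((G.vertCount U : ℤ) - 1) + 1)))
    (hconn : PSCDatum.VertCountLeNodeCountSuccHolds Ω)
    (hVC : ∀ ⦃Q : Type u⦄ [Group Q] [TopologicalSpace Q] [IsTopologicalGroup Q] (G : PSCDatum Q),
      Ω.IsOfPSCType G → G.IsSturdy → ∀ l : ℕ, G.Sigma = {l} → ∀ U : Subgroup Q, U.Normal →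
      IsOpen (U : Set Q) → G.unrKer ≤ U → ∀ S : Subgroup Q, U ≤ S →
      ((∃ (v : G.graph.V) (γ : ConjAct Q), S = U ⊔ γ • G.vertGp v) ↔
        ∃ H' : Subgroup Q,
          (H' ≤ U ∧ H' ≠ U ∧ IsOpen (H' : Set Q) ∧ (⁅U, U⁆ ⊔ G.unrKer).topologicalClosure ≤ H' ∧
            ∀ u ∈ U, u ^ l ∈ H') ∧
          (G.IsVerticiallyPurelyTotallyRamified U H' ∧ ∀ H'' : Subgroup Q,
            (H'' ≤ U ∧ H'' ≠ U ∧ IsOpen (H'' : Set Q) ∧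
                (⁅U, U⁆ ⊔ G.unrKer).topologicalClosure ≤ H'' ∧ ∀ u ∈ U, u ^ l ∈ H'') →
            G.IsVerticiallyPurelyTotallyRamified U H'' → H'' ≤ H' → H'' = H') ∧
          S = Subgroup.normalizer ((G.vertFil U ⊓ H' : Subgroup Q) : Set Q))) :
    UnrVerticialNecessityReduction Ω := by
  intro Q _ _ _ Q' _ _ _ G H β l hG hH hGs hHs hSG hSH _ _ _ _ _ _ hβ
  haveI : CompactSpace Q := hcpt G hG
  haveI : CompactSpace Q' := hcpt H hH
  haveI : TotallyDisconnectedSpace Q := htd G hG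
  haveI : TotallyDisconnectedSpace Q' := htd H hH
  exact PSCDatum.isUnrGroupTheoreticallyVerticial_of_isUnrVerticiallyFiltrationPreserving G H β hGs hHs
    hSG hSH (hrank G hG).1 (hrank H hH).1 (hRC G hG) (hRC H hH) (fun U hU _ => hconn G hG U hU)
    (fun U hU _ => hconn H hH U hU) (hVC G hG) (hVC H hH) hβ

/-! ### (v2, appended) The level-wise Rmk. 1.4.2 input from NAMED origin-level statements

abc-iut-w5-d174's `PSCDatum.verticialPureRamificationCount_levels_of_restrict`
(`PSCCoveringDatumRamificationProofs.lean`) derives the binder `hRC` for `G` from [IUTchI] Rmk. 1.2.3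
(iii) (`VerticialPureRamificationCount`) FOR THE COVERING DATA `G.restrict U hU` (abc-iut-L3-t4's
`PSCCoveringDatum.lean`); those are supplied by the origin-level statement
`CyclicCuspidallyTotallyRamifiedIffHolds Ω` once the coverings are known to be of `Ω`-type, i.e. by
the REPAIRED covering statement `RestrictBDOfPSCTypeHolds Ω` (`PSCCoveringBranchData.lean`: for
`G` of PSC-type there are branch data `bd` with every `G.restrictBD U hU bd` of PSC-type; the count
predicates of `restrictBD bd` and `restrict` coincide by `rfl`, finding F-L5t6g4-1 being about
`nodeEnds`/genera only).  So `hRC` disappears into names; only Rmk. 1.2.3 (iv)'s `hVC` remains a binder.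
-/

/-- **[IUTchI] Remark 1.2.3 (vii), necessity — the Rmk. 1.4.2 input discharged from named origin
statements.**  As `unrVerticialNecessityReduction_of_levelwise`, with the level-wise Rmk. 1.4.2 binder
replaced by `CyclicCuspidallyTotallyRamifiedIffHolds Ω` ([IUTchI] Rmk. 1.2.3 (iii), abc-iut-L3-t4)
together with `RestrictBDOfPSCTypeHolds Ω` ([CombGC] Def. 1.1 (ii): finite étale coverings of
PSC-type data are of PSC-type, abc-iut-L3-t4's repaired form), via abc-iut-w5-d174's
`verticialPureRamificationCount_levels_of_restrict` (BY NAME).  The remaining displayed hypothesis is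
Rmk. 1.2.3 (iv) read on stabilizers at every level (`hVC`, cell row G-w5d174-1).
[cite: Mochizuki2012, IUTchI Rmk 1.2.3 (vii) p.43] -/
theorem unrVerticialNecessityReduction_of_origin (Ω : PSCOrigin.{u})
    (hcpt : ∀ ⦃Q : Type u⦄ [Group Q] [TopologicalSpace Q] (G : PSCDatum Q),
      Ω.IsOfPSCType G → CompactSpace Q)
    (htd : ∀ ⦃Q : Type u⦄ [Group Q] [TopologicalSpace Q] (G : PSCDatum Q),
      Ω.IsOfPSCType G → TotallyDisconnectedSpace Q)
    (hrank : PSCDatum.RankStatementsHold Ω)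
    (hcount : PSCDatum.CyclicCuspidallyTotallyRamifiedIffHolds Ω)
    (hres : PSCDatum.RestrictBDOfPSCTypeHolds Ω)
    (hconn : PSCDatum.VertCountLeNodeCountSuccHolds Ω)
    (hVC : ∀ ⦃Q : Type u⦄ [Group Q] [TopologicalSpace Q] [IsTopologicalGroup Q] (G : PSCDatum Q),
      Ω.IsOfPSCType G → G.IsSturdy → ∀ l : ℕ, G.Sigma = {l} → ∀ U : Subgroup Q, U.Normal →
      IsOpen (U : Set Q) → G.unrKer ≤ U → ∀ S : Subgroup Q, U ≤ S →
      ((∃ (v : G.graph.V) (γ : ConjAct Q), S = U ⊔ γ • G.vertGp v) ↔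
        ∃ H' : Subgroup Q,
          (H' ≤ U ∧ H' ≠ U ∧ IsOpen (H' : Set Q) ∧ (⁅U, U⁆ ⊔ G.unrKer).topologicalClosure ≤ H' ∧
            ∀ u ∈ U, u ^ l ∈ H') ∧
          (G.IsVerticiallyPurelyTotallyRamified U H' ∧ ∀ H'' : Subgroup Q,
            (H'' ≤ U ∧ H'' ≠ U ∧ IsOpen (H'' : Set Q) ∧
                (⁅U, U⁆ ⊔ G.unrKer).topologicalClosure ≤ H'' ∧ ∀ u ∈ U, u ^ l ∈ H'') →
            G.IsVerticiallyPurelyTotallyRamified U H'' → H'' ≤ H' → H'' = H') ∧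
          S = Subgroup.normalizer ((G.vertFil U ⊓ H' : Subgroup Q) : Set Q))) :
    UnrVerticialNecessityReduction Ω := by
  refine unrVerticialNecessityReduction_of_levelwise Ω hcpt htd hrank (fun Q _ _ _ G hG => ?_) hconn hVC
  haveI : CompactSpace Q := hcpt G hG
  obtain ⟨bd, hbd⟩ := hres G hG
  refine PSCDatum.verticialPureRamificationCount_levels_of_restrict (G := G) fun U _ hU _ => ?_
  exact (hcount (G.restrictBD U hU bd) (hbd U hU)).2.1

/-! ### (v3, appended) All level-wise inputs from NAMED origin-level statements

[CombGC] Rmk. 1.4.2 for covering data is a THEOREM over the interface (abc-iut-w4-d016,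
`verticialPureRamificationCount_levels`); and abc-iut-w5-d174's
`vertexStabilizerCharacterization_levels_of_bodies` derives the last binder `hVC` from the STURDY-FREE
bodies of [IUTchI] Rmk. 1.2.3 (iv) for the covering data, which are shared definitionally between the
loop-degenerate `restrict` and the loop-faithful `restrictBD bd` (finding F-L5t6g4-1).  So both
binders disappear into names: the origin statements are applied to the `Ω`-type coverings
`G.restrictBD U hU bd` of `RestrictBDOfPSCTypeHolds Ω`.
-/

/-- **[IUTchI] Remark 1.2.3 (vii), necessity (`UnrVerticialNecessityReduction Ω`, cell fact F-1980)
for every profinite origin predicate, from NAMED origin-level statements only**: [CombGC] Rmk. 1.1.3 /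
1.3.1 (`RankStatementsHold Ω`, abc-iut-w4-d052), the repaired covering statement
`RestrictBDOfPSCTypeHolds Ω` and the connectivity of the coverings' graphs
`VertCountLeNodeCountSuccHolds Ω` (abc-iut-L3-t4 / w4-d052), and [IUTchI] Rmk. 1.2.3 (iv) as typed —
`UnrVerticialCharacterizationHolds Ω` (abc-iut-L3-t4) together with the rank of `M^unr[v]`,
`UnrVertAbOfRankHolds Ω` (abc-iut-w4-d052, [CombGC] Rmk. 1.1.5).  Route: the previous theorems, with
`hRC` := abc-iut-w4-d016's `verticialPureRamificationCount_levels` and `hVC` :=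
abc-iut-w5-d174's `vertexStabilizerCharacterization_levels_of_bodies` fed, at each level `U`, with the
bodies for the `Ω`-type covering `G.restrictBD U hU bd` (abc-iut-w4-d052's
`vertexQuotientCharacterization_of_inputs` / `vertexSetCharacterization_of_inputs`, abc-iut-w5-d174's
`exists_isElemAbUnrQuotient_inf_eq_vertexQuotientKer`; sturdiness by abc-iut-L3-t4's
`IsSturdy.restrictBD`). [cite: Mochizuki2012, IUTchI Rmk 1.2.3 (vii) p.43] -/
theorem unrVerticialNecessityReduction_of_originStatements (Ω : PSCOrigin.{u})
    (hcpt : ∀ ⦃Q : Type u⦄ [Group Q] [TopologicalSpace Q] (G : PSCDatum Q),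
      Ω.IsOfPSCType G → CompactSpace Q)
    (htd : ∀ ⦃Q : Type u⦄ [Group Q] [TopologicalSpace Q] (G : PSCDatum Q),
      Ω.IsOfPSCType G → TotallyDisconnectedSpace Q)
    (hrank : PSCDatum.RankStatementsHold Ω) (hres : PSCDatum.RestrictBDOfPSCTypeHolds Ω)
    (hconn : PSCDatum.VertCountLeNodeCountSuccHolds Ω)
    (hchar : PSCDatum.UnrVerticialCharacterizationHolds Ω) (hrk : PSCDatum.UnrVertAbOfRankHolds Ω) :
    UnrVerticialNecessityReduction Ω := by
  refine unrVerticialNecessityReduction_of_levelwise Ω hcpt htd hrank (fun Q _ _ _ G hG => ?_) hconn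
    (fun Q _ _ _ G hG hGs l hl => ?_)
  · haveI : CompactSpace Q := hcpt G hG
    exact G.verticialPureRamificationCount_levels
  · haveI : CompactSpace Q := hcpt G hG
    haveI : TotallyDisconnectedSpace Q := htd G hG
    haveI : T2Space Q := inferInstance
    obtain ⟨bd, hbd⟩ := hres G hG
    have hlP : l.Prime := G.sigma_prime l (by rw [hl]; exact Set.mem_singleton l)
    refine G.vertexStabilizerCharacterization_levels_of_bodies hl (fun U _ hU hKU => ?_)
      (fun U _ hU hKU => ?_) (fun U _ hU hKU => ?_) hGs l hl
    all_goals
      haveI : CompactSpace U :=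
        isCompact_iff_compactSpace.mp (Subgroup.isClosed_of_isOpen U hU).isCompact
      have hDs : (G.restrictBD U hU bd).IsSturdy := PSCDatum.IsSturdy.restrictBD G U hU bd hGs
      obtain ⟨hsplit, hiff⟩ := hchar (G.restrictBD U hU bd) (hbd U hU)
      have hrkD := hrk (G.restrictBD U hU bd) (hbd U hU)
    · exact (PSCDatum.vertexQuotientCharacterization_of_inputs _ hiff hsplit hrkD) hDs l hl
    · exact (PSCDatum.vertexSetCharacterization_of_inputs _ hsplit hrkD) hDs l hl
    · have hlS : l ∈ (G.restrictBD U hU bd).Sigma := by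
        rw [PSCDatum.restrictBD_Sigma, hl]; exact Set.mem_singleton l
      exact fun w => (G.restrictBD U hU bd).exists_isElemAbUnrQuotient_inf_eq_vertexQuotientKer
        hsplit hrkD hDs hlP hlS w

/-! ### (v4, appended) The same derivation over the CORRECTED split injection (abc-iut F-L3t4g5-1)

abc-iut-L3-t4 (gen 5) found that the frozen `PSCDatum.UnrVerticialSplitInjection` — hence the origin
statement `UnrVerticialCharacterizationHolds Ω` consumed as `hchar` above — mis-types the independence
clause at ONE-VERTEX data (it forces `Π` abelian for every smooth curve, `PSCUnrVerticialOneVertex.lean`),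
so `unrVerticialNecessityReduction_of_originStatements` is kernel-sound but VACUOUS at every origin
containing a one-vertex sturdy datum on a nonabelian group.  The successor predicate
`UnrVerticialSplitInjection'` / schema `UnrVerticialCharacterizationHolds'`
(`PSCRamificationSplitInjection.lean`, abc-iut-L3-t4) is satisfiable there, and abc-iut-w5-d174 (gen 4)
migrated the per-datum producers to it (`vertexQuotientKer_ne_unrVertAb'`,
`vertexQuotientCharacterization_mpr'`, `vertexSetCharacterization_of_inputs'`,
`exists_isElemAbUnrQuotient_inf_eq_vertexQuotientKer'` — no one-vertex case split is needed: the
corrected clause serves the "[nontrivial!]" step verbatim).  The theorem below is the v3 derivation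
with `hchar` replaced by the corrected `hchar'`; the (VQ) body is assembled at each covering datum from
abc-iut-w4-d052's forward half `vertexQuotientCharacterization_mp` and the primed pieces; everything
else is the same composition.
-/

/-- **[IUTchI] Remark 1.2.3 (vii), necessity (`UnrVerticialNecessityReduction Ω`, cell fact F-1980) for
every profinite origin predicate, from NAMED origin-level statements only, over the CORRECTED split
injection** (abc-iut F-L3t4g5-1): as `unrVerticialNecessityReduction_of_originStatements`, with
[IUTchI] Rmk. 1.2.3 (iv) as typed by its successor `UnrVerticialCharacterizationHolds' Ω`
(abc-iut-L3-t4, `PSCRamificationSplitInjection.lean`) — satisfiable at one-vertex data, where the frozen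
`UnrVerticialCharacterizationHolds Ω` is not.  Per-level producers: abc-iut-w4-d052's
`vertexQuotientCharacterization_mp` and abc-iut-w5-d174's `vertexQuotientKer_ne_unrVertAb'` /
`vertexQuotientCharacterization_mpr'` / `vertexSetCharacterization_of_inputs'` /
`exists_isElemAbUnrQuotient_inf_eq_vertexQuotientKer'`. [cite: Mochizuki2012, IUTchI Rmk 1.2.3 (vii) p.43] -/
theorem unrVerticialNecessityReduction_of_originStatements' (Ω : PSCOrigin.{u})
    (hcpt : ∀ ⦃Q : Type u⦄ [Group Q] [TopologicalSpace Q] (G : PSCDatum Q),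
      Ω.IsOfPSCType G → CompactSpace Q)
    (htd : ∀ ⦃Q : Type u⦄ [Group Q] [TopologicalSpace Q] (G : PSCDatum Q),
      Ω.IsOfPSCType G → TotallyDisconnectedSpace Q)
    (hrank : PSCDatum.RankStatementsHold Ω) (hres : PSCDatum.RestrictBDOfPSCTypeHolds Ω)
    (hconn : PSCDatum.VertCountLeNodeCountSuccHolds Ω)
    (hchar' : PSCDatum.UnrVerticialCharacterizationHolds' Ω) (hrk : PSCDatum.UnrVertAbOfRankHolds Ω) :
    UnrVerticialNecessityReduction Ω := by
  refine unrVerticialNecessityReduction_of_levelwise Ω hcpt htd hrank (fun Q _ _ _ G hG => ?_) hconn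
    (fun Q _ _ _ G hG hGs l hl => ?_)
  · haveI : CompactSpace Q := hcpt G hG
    exact G.verticialPureRamificationCount_levels
  · haveI : CompactSpace Q := hcpt G hG
    haveI : TotallyDisconnectedSpace Q := htd G hG
    haveI : T2Space Q := inferInstance
    obtain ⟨bd, hbd⟩ := hres G hG
    have hlP : l.Prime := G.sigma_prime l (by rw [hl]; exact Set.mem_singleton l)
    refine G.vertexStabilizerCharacterization_levels_of_bodies hl (fun U _ hU hKU => ?_)
      (fun U _ hU hKU => ?_) (fun U _ hU hKU => ?_) hGs l hl
    all_goals
      haveI : CompactSpace U :=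
        isCompact_iff_compactSpace.mp (Subgroup.isClosed_of_isOpen U hU).isCompact
      have hDs : (G.restrictBD U hU bd).IsSturdy := PSCDatum.IsSturdy.restrictBD G U hU bd hGs
      obtain ⟨hsplit, hiff⟩ := hchar' (G.restrictBD U hU bd) (hbd U hU)
      have hrkD := hrk (G.restrictBD U hU bd) (hbd U hU)
    · -- (VQ) at the covering datum: forward half by d052's `vertexQuotientCharacterization_mp` with
      -- "[nontrivial!]" from d174's `vertexQuotientKer_ne_unrVertAb'`, converse by d174's `_mpr'`
      intro H₁ hH₁
      have hlS : l ∈ (G.restrictBD U hU bd).Sigma := by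
        rw [PSCDatum.restrictBD_Sigma, hl]; exact Set.mem_singleton l
      have hK : ∀ w, (G.restrictBD U hU bd).vertexQuotientKer l w ≠ (G.restrictBD U hU bd).unrVertAb :=
        fun w => (G.restrictBD U hU bd).vertexQuotientKer_ne_unrVertAb' hsplit hrkD hDs hlS w
      have hSg : (G.restrictBD U hU bd).Sigma = {l} := by rw [PSCDatum.restrictBD_Sigma, hl]
      exact ⟨fun h => (G.restrictBD U hU bd).vertexQuotientCharacterization_mp hiff hDs hSg hK hH₁ h,
        fun h => (G.restrictBD U hU bd).vertexQuotientCharacterization_mpr' hiff hsplit hDs hSg hH₁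
          h.1 h.2⟩
    · exact (PSCDatum.vertexSetCharacterization_of_inputs' _ hsplit hrkD) hDs l hl
    · have hlS : l ∈ (G.restrictBD U hU bd).Sigma := by
        rw [PSCDatum.restrictBD_Sigma, hl]; exact Set.mem_singleton l
      exact fun w => (G.restrictBD U hU bd).exists_isElemAbUnrQuotient_inf_eq_vertexQuotientKer'
        hsplit hrkD hDs hlP hlS w

end Literature.IUT.HodgeTheaters.Rmk123
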